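import Summits.ValiantsHypothesis.ValiantsHypothesis.Theorems.LacunarySymmetroidMatrixDescartesPivotTwoDirectionsBlockLaw

/-!
# `MatrixDescartes` census — pivot column at `m = 2`: the BLOCK `(2,2)` LAW in the MIRROR interleaving chamber II
# (completing the beyond-Descartes part of «a sign-separated two-direction `(2,4)` hard-cell pencil has at most SIX positive roots»)

HONEST FRAMING.  Object-search cell `pub-symmetroid`, seat `val-sym-mdr-p1` (generation 12); helper file `--supports` the crux item
stmt-ValiantsHypothesis-18050 (`Theses.LacunarySymmetroid.MatrixDescartes`, OPEN, on HOLD) with NO closure claim.  Second half of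
`…PivotTwoDirectionsBlockLaw` (chamber I; engine: weighted Rolle `card_posRoots_le_kills`, four-nomial lemma
`card_posRoots_fourNomial_le_one`, nine-nomial `det_block22`).

**THEOREM (`chamberII_posRoots_le_six`, real-parameter form `nineNomial_chamberII_le_six`).**  `F = X^e J + c₁X^{p₁}u uᵀ + c₂X^{p₂}u uᵀ
+ c₃X^{q₁}v vᵀ + c₄X^{q₂}v vᵀ` (`p₂ < p₁ < e < q₁ < q₂`, `c₂, c₃, c₄ > 0`, `c₁` arbitrary, `v` pairing negatively with `J`,
`u, v` independent, `J` otherwise arbitrary) with gaps `aᵢ = e − pᵢ`, `bⱼ = qⱼ − e` in CHAMBER II: `a₁ < b₁ < a₂ − a₁`,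
`max(a₂ − a₁, a₁ + b₁) < b₂ < a₂` — the second and last exponent configuration in which the hard-cell nine-nomial `det F` alternates
perfectly (Descartes bound `8`) — has AT MOST SIX positive determinant roots.  Proof: kill `2e, e+p₁, e+p₂, p₁+q₁, p₁+q₂` (the block
`(c₂X^{p₂}u uᵀ + X^e J)·(v-letters)` survives at `p₂+q₁ < p₂+q₂ < e+q₁ < e+q₂`, shift `a₂`, offset `b₂ − b₁ < a₂`, signs `+ − + −`);
the cross ratio reduces by rank one to `(2e−p₂−q₂)(q₂+p₂−e−p₁)(p₁−p₂−q₂+q₁)·(q₁−p₁)(q₁−p₂)(q₂−q₁−e+p₁)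
< (2e−p₂−q₁)(e−p₁+q₂−q₁)(p₁−p₂+q₂−q₁)·(q₂−p₁)(q₂−p₂)(e+p₁−p₂−q₁)`, true factor by factor in the chamber.

THE BLOCK `(2,2)` LAW (paper assembly, recorded honestly): in a sign-separated two-direction hard-cell `(2,4)` pencil the nine
determinant coefficients in degree order begin and end with a negative one, so their number of sign variations is EVEN, and it equals
`8` exactly in chambers I and II (both treated in the kernel: `chamberI_posRoots_le_six`, `chamberII_posRoots_le_six`); in every other
configuration Descartes' rule gives `Z₊ ≤ 6` directly.  Hence `Z₊ ≤ 6 = 2K − 2` for the whole family, attained by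
`…PivotTwoDirectionsBlockSix`.  The Descartes bookkeeping over the remaining (≈ 25) exponent orders is NOT formalised here.
Nothing here bears on `MatrixDescartes` in its window, on `DoorA26` / `DoorA34`, registers / credences, or `VP ≠ VNP`.

[folklore] As in the companion: Rolle / mean value theorem, the kill-a-degree induction of Descartes' rule for fewnomials; no source
states the bound (presearch in the companion's header).  No definitions, no named facts.
-/

-- `Summit.ValiantsHypothesis.ValiantsHypothesis.…` repeats a component by the D-0017 layout
-- (single-conjunct summit), which the `dupNamespace` linter flags; the name is mandated.
set_option linter.dupNamespace false

namespace Summit.ValiantsHypothesis.ValiantsHypothesis.Theorems.LacunarySymmetroidMatrixDescartes.Pivot.TwoDirections.BlockLaw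

open Polynomial Matrix Finset
open scoped BigOperators

/-- **The nine-nomial of chamber II has at most six positive roots** (`mv < 0` = pairing of the `v`-direction with the pivot,
`Δ2 > 0`; `dJ`, `mu`, `c₁` arbitrary; chamber II: `a₁ < b₁ < a₂ − a₁`, `max(a₂ − a₁, a₁ + b₁) < b₂ < a₂`).  Kill
`2e, e+p₁, e+p₂, p₁+q₁, p₁+q₂`; survivors `p₂+q₁ < p₂+q₂ < e+q₁ < e+q₂` (shift `a₂`, offset `b₂ − b₁ < a₂`), signs `+ − + −`. -/
theorem nineNomial_chamberII_le_six (e p₁ p₂ q₁ q₂ : ℕ) (h21 : p₂ < p₁) (h1e : p₁ < e) (he1 : e < q₁) (h12 : q₁ < q₂)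
    (hII1 : 2 * e < q₁ + p₁) (hII2 : q₁ + p₂ < e + p₁) (hII3 : e + p₁ < q₂ + p₂) (hII4 : q₁ + e < q₂ + p₁)
    (hII5 : q₂ + p₂ < 2 * e)
    (dJ mu mv Δ2 c₁ c₂ c₃ c₄ : ℝ) (hc₂ : 0 < c₂) (hc₃ : 0 < c₃) (hc₄ : 0 < c₄) (hmv : mv < 0) (hΔ2p : 0 < Δ2) :
    ((∑ i : Fin 9, Polynomial.C ((![dJ, c₁ * mu, c₂ * mu, c₃ * mv, c₄ * mv, c₁ * c₃ * Δ2, c₂ * c₃ * Δ2, c₁ * c₄ * Δ2, c₂ * c₄ * Δ2] : Fin 9 → ℝ) i) * X ^ ((![2 * e, e + p₁, e + p₂, e + q₁, e + q₂, p₁ + q₁, p₂ + q₁, p₁ + q₂, p₂ + q₂] : Fin 9 → ℕ) i)).roots.toFinset.filter (fun t => 0 < t)).card ≤ 6 := by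
  classical
  have hp21 : (p₂ : ℝ) < p₁ := by exact_mod_cast h21
  have hp1e : (p₁ : ℝ) < e := by exact_mod_cast h1e
  have heq1 : (e : ℝ) < q₁ := by exact_mod_cast he1
  have hq12 : (q₁ : ℝ) < q₂ := by exact_mod_cast h12
  have hII1' : 2 * (e : ℝ) < q₁ + p₁ := by exact_mod_cast hII1
  have hII2' : (q₁ : ℝ) + p₂ < e + p₁ := by exact_mod_cast hII2
  have hII3' : (e : ℝ) + p₁ < q₂ + p₂ := by exact_mod_cast hII3
  have hII4' : (q₁ : ℝ) + e < q₂ + p₁ := by exact_mod_cast hII4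
  have hII5' : (q₂ : ℝ) + p₂ < 2 * e := by exact_mod_cast hII5
  have hnmv : 0 < -mv := by linarith
  obtain ⟨a1, ha1⟩ : ∃ x : ℝ, x = (e : ℝ) - p₁ := ⟨_, rfl⟩
  obtain ⟨b1, hb1⟩ : ∃ x : ℝ, x = (q₁ : ℝ) - e := ⟨_, rfl⟩
  obtain ⟨b2, hb2⟩ : ∃ x : ℝ, x = (q₂ : ℝ) - e := ⟨_, rfl⟩
  obtain ⟨g, hg⟩ : ∃ x : ℝ, x = (p₁ : ℝ) - p₂ := ⟨_, rfl⟩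
  obtain ⟨R1, hR1⟩ : ∃ x : ℝ, x = (q₁ : ℝ) - p₁ := ⟨_, rfl⟩
  obtain ⟨R2, hR2⟩ : ∃ x : ℝ, x = (q₁ : ℝ) - p₂ := ⟨_, rfl⟩
  obtain ⟨R3, hR3⟩ : ∃ x : ℝ, x = (p₁ : ℝ) - p₂ - q₂ + q₁ := ⟨_, rfl⟩
  obtain ⟨R4, hR4⟩ : ∃ x : ℝ, x = 2 * (e : ℝ) - p₂ - q₂ := ⟨_, rfl⟩
  obtain ⟨R5, hR5⟩ : ∃ x : ℝ, x = (q₂ : ℝ) + p₂ - e - p₁ := ⟨_, rfl⟩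
  obtain ⟨R6, hR6⟩ : ∃ x : ℝ, x = (q₂ : ℝ) - q₁ - e + p₁ := ⟨_, rfl⟩
  obtain ⟨L1, hL1⟩ : ∃ x : ℝ, x = (q₂ : ℝ) - p₁ := ⟨_, rfl⟩
  obtain ⟨L2, hL2⟩ : ∃ x : ℝ, x = (q₂ : ℝ) - p₂ := ⟨_, rfl⟩
  obtain ⟨L3, hL3⟩ : ∃ x : ℝ, x = (p₁ : ℝ) - p₂ + q₂ - q₁ := ⟨_, rfl⟩
  obtain ⟨L4, hL4⟩ : ∃ x : ℝ, x = 2 * (e : ℝ) - p₂ - q₁ := ⟨_, rfl⟩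
  obtain ⟨L5, hL5⟩ : ∃ x : ℝ, x = (e : ℝ) - p₁ + q₂ - q₁ := ⟨_, rfl⟩
  obtain ⟨L6, hL6⟩ : ∃ x : ℝ, x = (e : ℝ) + p₁ - p₂ - q₁ := ⟨_, rfl⟩
  have ha1p : 0 < a1 := by rw [ha1]; linarith
  have hb1p : 0 < b1 := by rw [hb1]; linarith
  have hb2p : 0 < b2 := by rw [hb2]; linarith
  have hgp : 0 < g := by rw [hg]; linarith
  have hR1p : 0 < R1 := by rw [hR1]; linarith
  have hR2p : 0 < R2 := by rw [hR2]; linarith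
  have hR3p : 0 < R3 := by rw [hR3]; linarith
  have hR4p : 0 < R4 := by rw [hR4]; linarith
  have hR5p : 0 < R5 := by rw [hR5]; linarith
  have hR6p : 0 < R6 := by rw [hR6]; linarith
  have f1 : R1 < L1 := by rw [hR1, hL1]; linarith
  have f2 : R2 < L2 := by rw [hR2, hL2]; linarith
  have f3 : R3 < L3 := by rw [hR3, hL3]; linarith
  have f4 : R4 < L4 := by rw [hR4, hL4]; linarith
  have f5 : R5 < L5 := by rw [hR5, hL5]; linarith
  have f6 : R6 < L6 := by rw [hR6, hL6]; linarith
  have hL3p : 0 < L3 := hR3p.trans f3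
  have hL4p : 0 < L4 := hR4p.trans f4
  have hL6p : 0 < L6 := hR6p.trans f6
  have hL1p : 0 < L1 := hR1p.trans f1
  have hL2p : 0 < L2 := hR2p.trans f2
  have hL5p : 0 < L5 := hR5p.trans f5
  obtain ⟨A, hA⟩ : ∃ x : ℝ, x = c₂ * c₃ * Δ2 * (b1 * g) * (L4 * L6 * L3) := ⟨_, rfl⟩
  obtain ⟨B, hB⟩ : ∃ x : ℝ, x = c₂ * c₄ * Δ2 * (b2 * g) * (R4 * R5 * R3) := ⟨_, rfl⟩
  obtain ⟨C, hC⟩ : ∃ x : ℝ, x = c₃ * (-mv) * (b1 * a1) * (R1 * R2 * R6) := ⟨_, rfl⟩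
  obtain ⟨D, hD⟩ : ∃ x : ℝ, x = c₄ * (-mv) * (b2 * a1) * (L1 * L2 * L5) := ⟨_, rfl⟩
  have hBp : 0 < B := by
    rw [hB]
    exact mul_pos (mul_pos (mul_pos (mul_pos hc₂ hc₄) hΔ2p) (mul_pos hb2p hgp)) (mul_pos (mul_pos hR4p hR5p) hR3p)
  have hDp : 0 < D := by
    rw [hD]
    exact mul_pos (mul_pos (mul_pos hc₄ hnmv) (mul_pos hb2p ha1p)) (mul_pos (mul_pos hL1p hL2p) hL5p)
  have hBC : B * C ≤ A * D := by
    have key : R4 * R5 * R3 * (R1 * R2 * R6) < L4 * L5 * L3 * (L1 * L2 * L6) := by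
      have m2 := mul_lt_mul'' f4 f5 hR4p.le hR5p.le
      have m3 := mul_lt_mul'' m2 f3 (mul_pos hR4p hR5p).le hR3p.le
      have n2 := mul_lt_mul'' f1 f2 hR1p.le hR2p.le
      have n3 := mul_lt_mul'' n2 f6 (mul_pos hR1p hR2p).le hR6p.le
      exact mul_lt_mul'' m3 n3 (mul_pos (mul_pos hR4p hR5p) hR3p).le (mul_pos (mul_pos hR1p hR2p) hR6p).le
    have common : 0 < c₂ * c₃ * c₄ * Δ2 * (-mv) * (a1 * b1 * b2 * g) :=
      mul_pos (mul_pos (mul_pos (mul_pos (mul_pos hc₂ hc₃) hc₄) hΔ2p) hnmv)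
        (mul_pos (mul_pos (mul_pos ha1p hb1p) hb2p) hgp)
    have eBC : B * C = c₂ * c₃ * c₄ * Δ2 * (-mv) * (a1 * b1 * b2 * g) * (R4 * R5 * R3 * (R1 * R2 * R6)) := by
      rw [hB, hC]; ring
    have eAD : A * D = c₂ * c₃ * c₄ * Δ2 * (-mv) * (a1 * b1 * b2 * g) * (L4 * L5 * L3 * (L1 * L2 * L6)) := by
      rw [hA, hD]; ring
    rw [eBC, eAD]
    exact mul_le_mul_of_nonneg_left key.le common.le
  have hkills := card_posRoots_le_kills (Finset.univ : Finset (Fin 9)) (![2 * e, e + p₁, e + p₂, e + q₁, e + q₂, p₁ + q₁, p₂ + q₁, p₁ + q₂, p₂ + q₂] : Fin 9 → ℕ) [2 * e, e + p₁, e + p₂, p₁ + q₁, p₁ + q₂] (![dJ, c₁ * mu, c₂ * mu, c₃ * mv, c₄ * mv, c₁ * c₃ * Δ2, c₂ * c₃ * Δ2, c₁ * c₄ * Δ2, c₂ * c₄ * Δ2] : Fin 9 → ℝ)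
  have hfour : (∑ i ∈ (Finset.univ : Finset (Fin 9)), Polynomial.C ((![dJ, c₁ * mu, c₂ * mu, c₃ * mv, c₄ * mv, c₁ * c₃ * Δ2, c₂ * c₃ * Δ2, c₁ * c₄ * Δ2, c₂ * c₄ * Δ2] : Fin 9 → ℝ) i
          * (([2 * e, e + p₁, e + p₂, p₁ + q₁, p₁ + q₂]).map (fun ρ : ℕ => ((((![2 * e, e + p₁, e + p₂, e + q₁, e + q₂, p₁ + q₁, p₂ + q₁, p₁ + q₂, p₂ + q₂] : Fin 9 → ℕ) i : ℕ) : ℝ) - (ρ : ℝ)))).prod) * X ^ ((![2 * e, e + p₁, e + p₂, e + q₁, e + q₂, p₁ + q₁, p₂ + q₁, p₁ + q₂, p₂ + q₂] : Fin 9 → ℕ) i))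
      = Polynomial.C A * X ^ (p₂ + q₁) - Polynomial.C B * X ^ (p₂ + q₁ + (q₂ - q₁))
          + Polynomial.C C * X ^ (p₂ + q₁ + (e - p₂)) - Polynomial.C D * X ^ (p₂ + q₁ + (q₂ - q₁) + (e - p₂)) := by
    have e3 : p₂ + q₁ + (q₂ - q₁) + (e - p₂) = e + q₂ := by omega
    have e1 : p₂ + q₁ + (q₂ - q₁) = p₂ + q₂ := by omega
    have e2 : p₂ + q₁ + (e - p₂) = e + q₁ := by omega
    rw [e3, e1, e2]
    have hcoef : ∀ i : Fin 9, (![dJ, c₁ * mu, c₂ * mu, c₃ * mv, c₄ * mv, c₁ * c₃ * Δ2, c₂ * c₃ * Δ2, c₁ * c₄ * Δ2, c₂ * c₄ * Δ2] : Fin 9 → ℝ) i * (([2 * e, e + p₁, e + p₂, p₁ + q₁, p₁ + q₂]).map (fun ρ : ℕ => ((((![2 * e, e + p₁, e + p₂, e + q₁, e + q₂, p₁ + q₁, p₂ + q₁, p₁ + q₂, p₂ + q₂] : Fin 9 → ℕ) i : ℕ) : ℝ) - (ρ : ℝ)))).prod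
        = (![0, 0, 0, C, -D, 0, A, 0, -B] : Fin 9 → ℝ) i := by
      intro i
      fin_cases i <;>
        simp only [Fin.zero_eta, Fin.mk_one, Fin.isValue, Matrix.cons_val_zero, Matrix.cons_val_one,
          List.map_cons, List.map_nil, List.prod_cons, List.prod_nil, hA, hB, hC, hD, ha1, hb1, hb2, hg, hR1, hR2, hR3,
          hR4, hR5, hR6, hL1, hL2, hL3, hL4, hL5, hL6] <;>
        push_cast <;> ring
    rw [Finset.sum_congr rfl (fun i _ => by rw [hcoef i])]
    simp only [Fin.sum_univ_succ, Fin.sum_univ_zero, Matrix.cons_val_zero, Matrix.cons_val_succ, map_zero, zero_mul,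
      zero_add, add_zero, Polynomial.C_neg]
    ring
  rw [hfour] at hkills
  have hone := card_posRoots_fourNomial_le_one A B C D hBp hDp hBC (p₂ + q₁) (q₂ - q₁) (e - p₂) (by omega)
  simp only [List.length_cons, List.length_nil] at hkills
  omega

/-- **BLOCK `(2,2)` LAW, CHAMBER II** (mirror of chamber I): two `u`-letters below the pivot (`c₂ > 0` at the lower exponent
`p₂`, `c₁` arbitrary), two `v`-letters above (`c₃, c₄ > 0`), `v` pairing negatively with `J` (`m(J,v) < 0`), `u, v` independent,
exponent gaps with `a₁ < b₁ < a₂ − a₁` and `max(a₂ − a₁, a₁ + b₁) < b₂ < a₂` (the second configuration in which the hard-cell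
nine-nomial alternates perfectly): at most SIX positive determinant roots. [this file] -/
theorem chamberII_posRoots_le_six (e p₁ p₂ q₁ q₂ : ℕ) (h21 : p₂ < p₁) (h1e : p₁ < e) (he1 : e < q₁) (h12 : q₁ < q₂)
    (hII1 : 2 * e < q₁ + p₁) (hII2 : q₁ + p₂ < e + p₁) (hII3 : e + p₁ < q₂ + p₂) (hII4 : q₁ + e < q₂ + p₁)
    (hII5 : q₂ + p₂ < 2 * e)
    (J : Matrix (Fin 2) (Fin 2) ℝ) (u v : Fin 2 → ℝ) (c₁ c₂ c₃ c₄ : ℝ) (hc₂ : 0 < c₂) (hc₃ : 0 < c₃) (hc₄ : 0 < c₄)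
    (hmv : J 0 0 * v 1 ^ 2 + J 1 1 * v 0 ^ 2 - (J 0 1 + J 1 0) * (v 0 * v 1) < 0) (hΔ : u 0 * v 1 - u 1 * v 0 ≠ 0) :
    ((Matrix.det (((X : ℝ[X]) ^ e) • J.map Polynomial.C
        + (Polynomial.C c₁ * X ^ p₁ + Polynomial.C c₂ * X ^ p₂) • (vecMulVec u u).map Polynomial.C
        + (Polynomial.C c₃ * X ^ q₁ + Polynomial.C c₄ * X ^ q₂) • (vecMulVec v v).map Polynomial.C)).roots.toFinset.filter
        (fun t => 0 < t)).card ≤ 6 := by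
  rw [det_block22]
  exact nineNomial_chamberII_le_six e p₁ p₂ q₁ q₂ h21 h1e he1 h12 hII1 hII2 hII3 hII4 hII5 J.det _ _ _ c₁ c₂ c₃ c₄ hc₂ hc₃
    hc₄ hmv (by positivity)

end Summit.ValiantsHypothesis.ValiantsHypothesis.Theorems.LacunarySymmetroidMatrixDescartes.Pivot.TwoDirections.BlockLaw
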